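/-
Copyright (c) 2026 the pub-hodgecm-mathlib formalisation cell (harness21).  Prover seat hodgecm-mathlib-F0P3-p02 (g16), 2026-09-01.  Road «S3-ram» seeding wave (LEAD F0P3a-plan (g12) T11-41∕T11-54∕T11-57;
owner F0P3a-p06 (g15)), row «(L)-ram» file L5-B: volumes of the two square-class halves of the rank-one interior stratum and the SPLIT integral of a `v`-level-one piece on `N`.
-/
import Literature.NumberTheory.Automorphic.HeisenbergLevelTwoStrataSplitRamified   -- ★ FILE L5-A (this seat): half-shells by residue square class, equal measures, chart preimages of `I₁^±`; ⊇ ★ FILE L2∕L1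
import HarnessLib

/-!
# The SPLIT integral of a `v`-level-one piece read on `N ∩ K₃` at a TAME-RAMIFIED place: the rank-one interior stratum by residue square class

Topic `NumberTheory/Automorphic`; namespace `Literature.NumberTheory.Automorphic.UnitaryGroup`.  KERNEL MATHEMATICS ONLY: theorems, no definition, no named fact, no `sorry`, no
instance, no notation.  Cell `pub/hodgecm-mathlib`, crux H413 = `stmt-HodgeConjecture-24833`; road «S3-ram» seeding wave (LEAD F0P3a-plan (g12); owner∕table F0P3a-p06 (g15)), row
**«(L)-ram», FILE L5-B** (seat F0P3-p02 (g16)); sequel of ★ FILE L5-A `HeisenbergLevelTwoStrataSplitRamified` and ★ FILE L2 `HeisenbergLevelTwoStrataRamified` (p846936).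
CONSUMER: the rank-one row (R4)∕(R5) of F0P2-p01 (g15)'s «(U)-ram TWO-LAYER HEAD» (value `c₁(ℓ)` by the residue square class `ℓ`), through the split `N ∩ K₃`-average (next file).
HONEST LABEL: HC_CM is proved only modulo the 2 remaining named inputs (hLiu418 24832, h413 24833) until rung 0 closes; «S3-ram» is Literature seeding; this file discharges nothing.

THE MATHEMATICS ([Rogawski1990] §4.9 p. 54, §12.2 p. 173; [Jacobowitz1962] §5; [Kottwitz1986] §3).  `v` non-split, TAMELY RAMIFIED (`e(w|v) ≠ 1`, `|2|_w = 1`, `q = N𝔭_v`), `ϖ ∈ L_w` with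
`|ϖ| = exp(−1)`.  By ★ FILE L5-A the rank-one interior stratum `I₁` of `N ∩ K₃` is the disjoint union of `I₁⁺ = {red(ϖ⁻¹(n_w)₀₂) ∈ (𝓀^×)²}` and `I₁⁻`, with chart preimages
`{|x_w| ≤ e⁻²} × half^±` and `μ⁻(half⁺) = μ⁻(half⁻)`, `μ⁻(half⁺) + μ⁻(half⁻) = μ⁻(shell)`.  With the product form of every Haar measure of `N` (★ FILE B §2) and ★ FILE L2's
`μ_N(I₁) = q⁻²(1 − q⁻¹)·μ_N(N ∩ K₃)`: **`μ_N(I₁⁺) = μ_N(I₁⁻) = ½q⁻²(1 − q⁻¹)·μ_N(N ∩ K₃)`**, and a function `F : N → ℂ` vanishing off `K₃` with values `v₅` (boundary-regular),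
`v₃, v₂⁺, v₂⁻, v₁` (interior: regular, rank-one square class, rank-one non-square class, zero) has
**`∫_N F dμ_N = μ_N(N ∩ K₃)·(v₅(1 − q⁻¹) + q⁻¹·(v₃(1 − q⁻¹) + ½(v₂⁺ + v₂⁻)·q⁻¹(1 − q⁻¹) + v₁·q⁻²))`** (`integral_eq_of_levelTwo_strata_split_of_ramified`; ★ FILE L2's
`integral_eq_of_levelTwo_strata_of_ramified` is the case `v₂⁺ = v₂⁻`).

## References
* [Rogawski1990] J. D. Rogawski, *Automorphic Representations of Unitary Groups in Three Variables*, Ann. of Math. Stud. 123 (1990), §1.10 p. 9; §4.9 p. 54; §12.2 p. 173.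
* [Jacobowitz1962] R. Jacobowitz, *Hermitian forms over local fields*, Amer. J. Math. 84 (1962), §5.
* [Kottwitz1986] R. E. Kottwitz, *Base change for unit elements of Hecke algebras*, Compositio Math. 60 (1986), §3.
* [GetzHahn2024] J. Getz, H. Hahn, *An Introduction to Automorphic Representations*, GTM 300 (2024), §3.5 (3.10).
-/

set_option autoImplicit false

noncomputable section

open IsDedekindDomain NumberField Matrix MeasureTheory Measure Topology
open scoped NumberField MatrixGroups Matrix NNReal ENNReal WithZero ValuativeRel Pointwise

namespace Literature.NumberTheory.Automorphic.UnitaryGroup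

open Literature.NumberTheory.Automorphic Literature.NumberTheory.Automorphic.IntegralReduction Literature.NumberTheory.GaloisRepresentations

variable (L : Type) [Field L] [NumberField L] [IsCMField L] (v : HeightOneSpectrum (𝓞 ↥(maximalRealSubfield L)))
  (w : PlacesOver L v) (hw : IsCMField.complexConj L • w.1 = w.1)

/-! ## §1 Volumes of the two halves and the split integral formula -/

set_option maxHeartbeats 800000 in
include hw in
/-- **THE TWO HALVES OF THE RANK-ONE INTERIOR STRATUM HAVE EQUAL VOLUME `½q⁻²(1 − q⁻¹)·μ_N(N ∩ K₃)`** for EVERY Haar measure `μ_N` of `N`, any `ϖ` with `|ϖ| = exp(−1)`,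
at a tame-ramified place (product form ★ FILE B §2 over the chart preimages of §2 and the equal half-shells of §1; the whole stratum is ★ FILE L2's `q⁻²(1 − q⁻¹)`).
[cite: Rogawski1990, §4.9 p. 54; §12.2 p. 173] [cite: Jacobowitz1962, §5] -/
theorem measureReal_levelTwoStratum_one_isSquare_of_ramified [MeasurableSpace ↥(unipotentU (conjLocal L (IsCMField.complexConj L) v) (cmLocalForm L 3 v))] [BorelSpace ↥(unipotentU (conjLocal L (IsCMField.complexConj L) v) (cmLocalForm L 3 v))] (μN : Measure ↥(unipotentU (conjLocal L (IsCMField.complexConj L) v) (cmLocalForm L 3 v))) [μN.IsHaarMeasure]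
    {ϖ : w.1.adicCompletion L} (hϖ : Valued.v ϖ = WithZero.exp (-1 : ℤ)) (he : v.asIdeal.ramificationIdx' w.1.asIdeal ≠ 1) (h2w : Valued.v (2 : w.1.adicCompletion L) = 1) :
    μN.real {n : ↥(unipotentU (conjLocal L (IsCMField.complexConj L) v) (cmLocalForm L 3 v)) | (n : ↥(unitaryGroupOfForm (conjLocal L (IsCMField.complexConj L) v) (cmLocalForm L 3 v))) ∈ cmLocalIntegralLevel L 3 (Matrix.of fun i j : Fin 3 => if i.val + j.val + 1 = 3 then (1 : L) else 0) v ∧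
        (redMat (((n : ↥(unitaryGroupOfForm (conjLocal L (IsCMField.complexConj L) v) (cmLocalForm L 3 v))) : GL (Fin 3) (LocalRing L v)).val.map (Pi.evalRingHom (fun w' : PlacesOver L v => w'.1.adicCompletion L) w)) - 1).rank = 0 ∧
        (redMat (ϖ⁻¹ • ((((n : ↥(unitaryGroupOfForm (conjLocal L (IsCMField.complexConj L) v) (cmLocalForm L 3 v))) : GL (Fin 3) (LocalRing L v)).val.map (Pi.evalRingHom (fun w' : PlacesOver L v => w'.1.adicCompletion L) w)) - 1))).rank = 1 ∧ IsSquare (red (ϖ⁻¹ * (((n : ↥(unitaryGroupOfForm (conjLocal L (IsCMField.complexConj L) v) (cmLocalForm L 3 v))) : GL (Fin 3) (LocalRing L v)).val.map (Pi.evalRingHom (fun w' : PlacesOver L v => w'.1.adicCompletion L) w)) 0 2))} =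
      2⁻¹ * (((Ideal.absNorm v.asIdeal : ℝ) ^ 2)⁻¹ * (1 - (Ideal.absNorm v.asIdeal : ℝ)⁻¹)) * μN.real {n : ↥(unipotentU (conjLocal L (IsCMField.complexConj L) v) (cmLocalForm L 3 v)) | (n : ↥(unitaryGroupOfForm (conjLocal L (IsCMField.complexConj L) v) (cmLocalForm L 3 v))) ∈ cmLocalIntegralLevel L 3 (Matrix.of fun i j : Fin 3 => if i.val + j.val + 1 = 3 then (1 : L) else 0) v} ∧
    μN.real {n : ↥(unipotentU (conjLocal L (IsCMField.complexConj L) v) (cmLocalForm L 3 v)) | (n : ↥(unitaryGroupOfForm (conjLocal L (IsCMField.complexConj L) v) (cmLocalForm L 3 v))) ∈ cmLocalIntegralLevel L 3 (Matrix.of fun i j : Fin 3 => if i.val + j.val + 1 = 3 then (1 : L) else 0) v ∧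
        (redMat (((n : ↥(unitaryGroupOfForm (conjLocal L (IsCMField.complexConj L) v) (cmLocalForm L 3 v))) : GL (Fin 3) (LocalRing L v)).val.map (Pi.evalRingHom (fun w' : PlacesOver L v => w'.1.adicCompletion L) w)) - 1).rank = 0 ∧
        (redMat (ϖ⁻¹ • ((((n : ↥(unitaryGroupOfForm (conjLocal L (IsCMField.complexConj L) v) (cmLocalForm L 3 v))) : GL (Fin 3) (LocalRing L v)).val.map (Pi.evalRingHom (fun w' : PlacesOver L v => w'.1.adicCompletion L) w)) - 1))).rank = 1 ∧ ¬ IsSquare (red (ϖ⁻¹ * (((n : ↥(unitaryGroupOfForm (conjLocal L (IsCMField.complexConj L) v) (cmLocalForm L 3 v))) : GL (Fin 3) (LocalRing L v)).val.map (Pi.evalRingHom (fun w' : PlacesOver L v => w'.1.adicCompletion L) w)) 0 2))} =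
      2⁻¹ * (((Ideal.absNorm v.asIdeal : ℝ) ^ 2)⁻¹ * (1 - (Ideal.absNorm v.asIdeal : ℝ)⁻¹)) * μN.real {n : ↥(unipotentU (conjLocal L (IsCMField.complexConj L) v) (cmLocalForm L 3 v)) | (n : ↥(unitaryGroupOfForm (conjLocal L (IsCMField.complexConj L) v) (cmLocalForm L 3 v))) ∈ cmLocalIntegralLevel L 3 (Matrix.of fun i j : Fin 3 => if i.val + j.val + 1 = 3 then (1 : L) else 0) v} := by
  haveI : SecondCountableTopology (LocalRing L v) := secondCountableTopology_localRing (E := L) v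
  letI : MeasurableSpace (LocalRing L v) := borel _
  haveI : BorelSpace (LocalRing L v) := ⟨rfl⟩
  letI : Invertible (2 : LocalRing L v) := (isUnit_two_localRing L v).invertible
  haveI := HeisRing.locallyCompactSpace_skewPart (conjLocal L (IsCMField.complexConj L) v) (continuous_conjLocal L (IsCMField.complexConj L) v)
  haveI : SecondCountableTopology ↥(HeisRing.skewPart (conjLocal L (IsCMField.complexConj L) v)) := TopologicalSpace.Subtype.secondCountableTopology _
  obtain ⟨μX, hμX⟩ : ∃ μ : Measure (LocalRing L v), μ = Measure.addHaar := ⟨_, rfl⟩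
  obtain ⟨μY, hμY⟩ : ∃ μ : Measure ↥(HeisRing.skewPart (conjLocal L (IsCMField.complexConj L) v)), μ = Measure.addHaar := ⟨_, rfl⟩
  haveI : μX.IsAddHaarMeasure := by rw [hμX]; infer_instance
  haveI : μY.IsAddHaarMeasure := by rw [hμY]; infer_instance
  haveI : μY.Regular := by rw [hμY]; infer_instance
  obtain ⟨κ, hκ⟩ := exists_measure_eq_mul_of_preimage_heisHomeomorph L v μN μX μY
  obtain ⟨hpreP, hpreM⟩ := preimage_heisHomeomorph_levelTwoStratum_one_isSquare_of_ramified L v w hw hϖ h2w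
  have hpre1 := preimage_heisHomeomorph_levelTwoStratum_one_of_valued_eq L v w hw hϖ h2w
  obtain ⟨hYeq, hYsum⟩ := measure_skewShell_isSquare_eq_of_ramified L v w hw μY hϖ he h2w
  have hP := hκ _ _ _ hpreP
  have hM := hκ _ _ _ hpreM
  have h1 := hκ _ _ _ hpre1
  have htot := measureReal_levelTwoStratum_one_of_ramified L v w hw μN hϖ he h2w
  -- `μN(I₁^±) = κ·μ_R(ϖ_v𝒪)·μ⁻(half^±)` and `μN(I₁) = κ·μ_R(ϖ_v𝒪)·(μ⁻(half⁺) + μ⁻(half⁻))` with equal halves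
  have hrealP : μN.real {n : ↥(unipotentU (conjLocal L (IsCMField.complexConj L) v) (cmLocalForm L 3 v)) | (n : ↥(unitaryGroupOfForm (conjLocal L (IsCMField.complexConj L) v) (cmLocalForm L 3 v))) ∈ cmLocalIntegralLevel L 3 (Matrix.of fun i j : Fin 3 => if i.val + j.val + 1 = 3 then (1 : L) else 0) v ∧
        (redMat (((n : ↥(unitaryGroupOfForm (conjLocal L (IsCMField.complexConj L) v) (cmLocalForm L 3 v))) : GL (Fin 3) (LocalRing L v)).val.map (Pi.evalRingHom (fun w' : PlacesOver L v => w'.1.adicCompletion L) w)) - 1).rank = 0 ∧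
        (redMat (ϖ⁻¹ • ((((n : ↥(unitaryGroupOfForm (conjLocal L (IsCMField.complexConj L) v) (cmLocalForm L 3 v))) : GL (Fin 3) (LocalRing L v)).val.map (Pi.evalRingHom (fun w' : PlacesOver L v => w'.1.adicCompletion L) w)) - 1))).rank = 1 ∧ IsSquare (red (ϖ⁻¹ * (((n : ↥(unitaryGroupOfForm (conjLocal L (IsCMField.complexConj L) v) (cmLocalForm L 3 v))) : GL (Fin 3) (LocalRing L v)).val.map (Pi.evalRingHom (fun w' : PlacesOver L v => w'.1.adicCompletion L) w)) 0 2))} =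
      2⁻¹ * μN.real {n : ↥(unipotentU (conjLocal L (IsCMField.complexConj L) v) (cmLocalForm L 3 v)) | (n : ↥(unitaryGroupOfForm (conjLocal L (IsCMField.complexConj L) v) (cmLocalForm L 3 v))) ∈ cmLocalIntegralLevel L 3 (Matrix.of fun i j : Fin 3 => if i.val + j.val + 1 = 3 then (1 : L) else 0) v ∧
        (redMat (((n : ↥(unitaryGroupOfForm (conjLocal L (IsCMField.complexConj L) v) (cmLocalForm L 3 v))) : GL (Fin 3) (LocalRing L v)).val.map (Pi.evalRingHom (fun w' : PlacesOver L v => w'.1.adicCompletion L) w)) - 1).rank = 0 ∧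
        (redMat (ϖ⁻¹ • ((((n : ↥(unitaryGroupOfForm (conjLocal L (IsCMField.complexConj L) v) (cmLocalForm L 3 v))) : GL (Fin 3) (LocalRing L v)).val.map (Pi.evalRingHom (fun w' : PlacesOver L v => w'.1.adicCompletion L) w)) - 1))).rank = 1} := by
    rw [measureReal_def, measureReal_def, hP, h1, ← hYsum, ← hYeq, ← two_mul, ENNReal.toReal_mul, ENNReal.toReal_mul, ENNReal.toReal_mul, ENNReal.toReal_mul,
      ENNReal.toReal_mul, ENNReal.toReal_ofNat]
    ring
  have hrealM : μN.real {n : ↥(unipotentU (conjLocal L (IsCMField.complexConj L) v) (cmLocalForm L 3 v)) | (n : ↥(unitaryGroupOfForm (conjLocal L (IsCMField.complexConj L) v) (cmLocalForm L 3 v))) ∈ cmLocalIntegralLevel L 3 (Matrix.of fun i j : Fin 3 => if i.val + j.val + 1 = 3 then (1 : L) else 0) v ∧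
        (redMat (((n : ↥(unitaryGroupOfForm (conjLocal L (IsCMField.complexConj L) v) (cmLocalForm L 3 v))) : GL (Fin 3) (LocalRing L v)).val.map (Pi.evalRingHom (fun w' : PlacesOver L v => w'.1.adicCompletion L) w)) - 1).rank = 0 ∧
        (redMat (ϖ⁻¹ • ((((n : ↥(unitaryGroupOfForm (conjLocal L (IsCMField.complexConj L) v) (cmLocalForm L 3 v))) : GL (Fin 3) (LocalRing L v)).val.map (Pi.evalRingHom (fun w' : PlacesOver L v => w'.1.adicCompletion L) w)) - 1))).rank = 1 ∧ ¬ IsSquare (red (ϖ⁻¹ * (((n : ↥(unitaryGroupOfForm (conjLocal L (IsCMField.complexConj L) v) (cmLocalForm L 3 v))) : GL (Fin 3) (LocalRing L v)).val.map (Pi.evalRingHom (fun w' : PlacesOver L v => w'.1.adicCompletion L) w)) 0 2))} =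
      2⁻¹ * μN.real {n : ↥(unipotentU (conjLocal L (IsCMField.complexConj L) v) (cmLocalForm L 3 v)) | (n : ↥(unitaryGroupOfForm (conjLocal L (IsCMField.complexConj L) v) (cmLocalForm L 3 v))) ∈ cmLocalIntegralLevel L 3 (Matrix.of fun i j : Fin 3 => if i.val + j.val + 1 = 3 then (1 : L) else 0) v ∧
        (redMat (((n : ↥(unitaryGroupOfForm (conjLocal L (IsCMField.complexConj L) v) (cmLocalForm L 3 v))) : GL (Fin 3) (LocalRing L v)).val.map (Pi.evalRingHom (fun w' : PlacesOver L v => w'.1.adicCompletion L) w)) - 1).rank = 0 ∧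
        (redMat (ϖ⁻¹ • ((((n : ↥(unitaryGroupOfForm (conjLocal L (IsCMField.complexConj L) v) (cmLocalForm L 3 v))) : GL (Fin 3) (LocalRing L v)).val.map (Pi.evalRingHom (fun w' : PlacesOver L v => w'.1.adicCompletion L) w)) - 1))).rank = 1} := by
    rw [measureReal_def, measureReal_def, hM, h1, ← hYsum, hYeq, ← two_mul, ENNReal.toReal_mul, ENNReal.toReal_mul, ENNReal.toReal_mul, ENNReal.toReal_mul,
      ENNReal.toReal_mul, ENNReal.toReal_ofNat]
    ring
  rw [hrealP, hrealM, htot]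
  exact ⟨by ring, by ring⟩

set_option maxHeartbeats 1600000 in
include hw in
/-- **THE SPLIT INTEGRAL FORMULA AT A TAME-RAMIFIED PLACE**: for EVERY Haar measure `μ_N` of `N`, any `ϖ` with `|ϖ| = exp(−1)`, and `F : N → ℂ` vanishing off `K₃` with values
`v₅` (boundary-regular), `v₃` (interior regular), `v₂⁺ ∕ v₂⁻` (interior rank one, square ∕ non-square residue class of `red(ϖ⁻¹(n_w)₀₂)`), `v₁` (interior zero):
**`∫_N F dμ_N = μ_N(N ∩ K₃)·(v₅(1 − q⁻¹) + q⁻¹·(v₃(1 − q⁻¹) + ½(v₂⁺ + v₂⁻)·q⁻¹(1 − q⁻¹) + v₁·q⁻²))`** (★ FILE L2's formula is the case `v₂⁺ = v₂⁻`).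
[cite: Rogawski1990, §4.9 p. 54; §12.2 p. 173] [cite: Kottwitz1986, §3] [cite: Jacobowitz1962, §5] -/
theorem integral_eq_of_levelTwo_strata_split_of_ramified [MeasurableSpace ↥(unipotentU (conjLocal L (IsCMField.complexConj L) v) (cmLocalForm L 3 v))] [BorelSpace ↥(unipotentU (conjLocal L (IsCMField.complexConj L) v) (cmLocalForm L 3 v))] (μN : Measure ↥(unipotentU (conjLocal L (IsCMField.complexConj L) v) (cmLocalForm L 3 v))) [μN.IsHaarMeasure]
    {ϖ : w.1.adicCompletion L} (hϖ : Valued.v ϖ = WithZero.exp (-1 : ℤ)) (he : v.asIdeal.ramificationIdx' w.1.asIdeal ≠ 1) (h2w : Valued.v (2 : w.1.adicCompletion L) = 1) (v₁ v₂p v₂m v₃ v₅ : ℂ)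
    (F : ↥(unipotentU (conjLocal L (IsCMField.complexConj L) v) (cmLocalForm L 3 v)) → ℂ)
    (hF₅ : ∀ n : ↥(unipotentU (conjLocal L (IsCMField.complexConj L) v) (cmLocalForm L 3 v)), (n : ↥(unitaryGroupOfForm (conjLocal L (IsCMField.complexConj L) v) (cmLocalForm L 3 v))) ∈
          cmLocalIntegralLevel L 3 (Matrix.of fun i j : Fin 3 => if i.val + j.val + 1 = 3 then (1 : L) else 0) v →
        (redMat (((n : ↥(unitaryGroupOfForm (conjLocal L (IsCMField.complexConj L) v) (cmLocalForm L 3 v))) : GL (Fin 3) (LocalRing L v)).val.map (Pi.evalRingHom (fun w' : PlacesOver L v => w'.1.adicCompletion L) w)) - 1).rank = 2 →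
        F n = v₅)
    (hF₃ : ∀ n : ↥(unipotentU (conjLocal L (IsCMField.complexConj L) v) (cmLocalForm L 3 v)), (n : ↥(unitaryGroupOfForm (conjLocal L (IsCMField.complexConj L) v) (cmLocalForm L 3 v))) ∈
          cmLocalIntegralLevel L 3 (Matrix.of fun i j : Fin 3 => if i.val + j.val + 1 = 3 then (1 : L) else 0) v →
        (redMat (((n : ↥(unitaryGroupOfForm (conjLocal L (IsCMField.complexConj L) v) (cmLocalForm L 3 v))) : GL (Fin 3) (LocalRing L v)).val.map (Pi.evalRingHom (fun w' : PlacesOver L v => w'.1.adicCompletion L) w)) - 1).rank = 0 →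
        (redMat (ϖ⁻¹ • ((((n : ↥(unitaryGroupOfForm (conjLocal L (IsCMField.complexConj L) v) (cmLocalForm L 3 v))) : GL (Fin 3) (LocalRing L v)).val.map (Pi.evalRingHom (fun w' : PlacesOver L v => w'.1.adicCompletion L) w)) - 1))).rank = 2 →
        F n = v₃)
    (hF₂p : ∀ n : ↥(unipotentU (conjLocal L (IsCMField.complexConj L) v) (cmLocalForm L 3 v)), (n : ↥(unitaryGroupOfForm (conjLocal L (IsCMField.complexConj L) v) (cmLocalForm L 3 v))) ∈
          cmLocalIntegralLevel L 3 (Matrix.of fun i j : Fin 3 => if i.val + j.val + 1 = 3 then (1 : L) else 0) v →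
        (redMat (((n : ↥(unitaryGroupOfForm (conjLocal L (IsCMField.complexConj L) v) (cmLocalForm L 3 v))) : GL (Fin 3) (LocalRing L v)).val.map (Pi.evalRingHom (fun w' : PlacesOver L v => w'.1.adicCompletion L) w)) - 1).rank = 0 →
        (redMat (ϖ⁻¹ • ((((n : ↥(unitaryGroupOfForm (conjLocal L (IsCMField.complexConj L) v) (cmLocalForm L 3 v))) : GL (Fin 3) (LocalRing L v)).val.map (Pi.evalRingHom (fun w' : PlacesOver L v => w'.1.adicCompletion L) w)) - 1))).rank = 1 → IsSquare (red (ϖ⁻¹ * (((n : ↥(unitaryGroupOfForm (conjLocal L (IsCMField.complexConj L) v) (cmLocalForm L 3 v))) : GL (Fin 3) (LocalRing L v)).val.map (Pi.evalRingHom (fun w' : PlacesOver L v => w'.1.adicCompletion L) w)) 0 2)) →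
        F n = v₂p)
    (hF₂m : ∀ n : ↥(unipotentU (conjLocal L (IsCMField.complexConj L) v) (cmLocalForm L 3 v)), (n : ↥(unitaryGroupOfForm (conjLocal L (IsCMField.complexConj L) v) (cmLocalForm L 3 v))) ∈
          cmLocalIntegralLevel L 3 (Matrix.of fun i j : Fin 3 => if i.val + j.val + 1 = 3 then (1 : L) else 0) v →
        (redMat (((n : ↥(unitaryGroupOfForm (conjLocal L (IsCMField.complexConj L) v) (cmLocalForm L 3 v))) : GL (Fin 3) (LocalRing L v)).val.map (Pi.evalRingHom (fun w' : PlacesOver L v => w'.1.adicCompletion L) w)) - 1).rank = 0 →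
        (redMat (ϖ⁻¹ • ((((n : ↥(unitaryGroupOfForm (conjLocal L (IsCMField.complexConj L) v) (cmLocalForm L 3 v))) : GL (Fin 3) (LocalRing L v)).val.map (Pi.evalRingHom (fun w' : PlacesOver L v => w'.1.adicCompletion L) w)) - 1))).rank = 1 → ¬ IsSquare (red (ϖ⁻¹ * (((n : ↥(unitaryGroupOfForm (conjLocal L (IsCMField.complexConj L) v) (cmLocalForm L 3 v))) : GL (Fin 3) (LocalRing L v)).val.map (Pi.evalRingHom (fun w' : PlacesOver L v => w'.1.adicCompletion L) w)) 0 2)) →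
        F n = v₂m)
    (hF₁ : ∀ n : ↥(unipotentU (conjLocal L (IsCMField.complexConj L) v) (cmLocalForm L 3 v)), (n : ↥(unitaryGroupOfForm (conjLocal L (IsCMField.complexConj L) v) (cmLocalForm L 3 v))) ∈
          cmLocalIntegralLevel L 3 (Matrix.of fun i j : Fin 3 => if i.val + j.val + 1 = 3 then (1 : L) else 0) v →
        (redMat (((n : ↥(unitaryGroupOfForm (conjLocal L (IsCMField.complexConj L) v) (cmLocalForm L 3 v))) : GL (Fin 3) (LocalRing L v)).val.map (Pi.evalRingHom (fun w' : PlacesOver L v => w'.1.adicCompletion L) w)) - 1).rank = 0 →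
        (redMat (ϖ⁻¹ • ((((n : ↥(unitaryGroupOfForm (conjLocal L (IsCMField.complexConj L) v) (cmLocalForm L 3 v))) : GL (Fin 3) (LocalRing L v)).val.map (Pi.evalRingHom (fun w' : PlacesOver L v => w'.1.adicCompletion L) w)) - 1))).rank = 0 →
        F n = v₁)
    (hF₀ : ∀ n : ↥(unipotentU (conjLocal L (IsCMField.complexConj L) v) (cmLocalForm L 3 v)), (n : ↥(unitaryGroupOfForm (conjLocal L (IsCMField.complexConj L) v) (cmLocalForm L 3 v))) ∉
          cmLocalIntegralLevel L 3 (Matrix.of fun i j : Fin 3 => if i.val + j.val + 1 = 3 then (1 : L) else 0) v → F n = 0) :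
    ∫ n, F n ∂μN =
      (μN.real {n : ↥(unipotentU (conjLocal L (IsCMField.complexConj L) v) (cmLocalForm L 3 v)) | (n : ↥(unitaryGroupOfForm (conjLocal L (IsCMField.complexConj L) v) (cmLocalForm L 3 v))) ∈ cmLocalIntegralLevel L 3 (Matrix.of fun i j : Fin 3 => if i.val + j.val + 1 = 3 then (1 : L) else 0) v} : ℂ) *
        (v₅ * (1 - (Ideal.absNorm v.asIdeal : ℂ)⁻¹) +
          (Ideal.absNorm v.asIdeal : ℂ)⁻¹ * (v₃ * (1 - (Ideal.absNorm v.asIdeal : ℂ)⁻¹) + 2⁻¹ * (v₂p + v₂m) * ((Ideal.absNorm v.asIdeal : ℂ)⁻¹ * (1 - (Ideal.absNorm v.asIdeal : ℂ)⁻¹)) +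
            v₁ * ((Ideal.absNorm v.asIdeal : ℂ) ^ 2)⁻¹)) := by
  haveI : SecondCountableTopology (LocalRing L v) := secondCountableTopology_localRing (E := L) v
  letI : MeasurableSpace (LocalRing L v) := borel _
  haveI : BorelSpace (LocalRing L v) := ⟨rfl⟩
  letI : Invertible (2 : LocalRing L v) := (isUnit_two_localRing L v).invertible
  haveI : SecondCountableTopology ↥(HeisRing.skewPart (conjLocal L (IsCMField.complexConj L) v)) := TopologicalSpace.Subtype.secondCountableTopology _
  have hq : (Ideal.absNorm v.asIdeal : ℂ) ≠ 0 := by exact_mod_cast fun h => v.ne_bot (Ideal.absNorm_eq_zero_iff.1 h)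
  obtain ⟨he1, he2, he21⟩ := exp_neg_lt_one
  obtain ⟨hNO, hS2, -, -⟩ := measurableSet_level_and_rankStrata L v w hw h2w
  -- the interior strata are Borel: images of Borel products under the chart
  have hA1o : IsOpen {x : LocalRing L v | Valued.v (x w) < 1} := isOpen_setOf_valued_apply_lt_one L v w
  have hA2o : IsOpen {x : LocalRing L v | Valued.v (x w) ≤ WithZero.exp (-2 : ℤ)} := isOpen_setOf_valued_apply_le_exp_neg_two_of_ramified L v w hw he
  have hB1o : IsOpen {y : HeisRing.skewPart (conjLocal L (IsCMField.complexConj L) v) | Valued.v ((y : LocalRing L v) w) < 1} := (isOpen_setOf_valued_apply_lt_one L v w).preimage continuous_subtype_val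
  have hB2o : IsOpen {y : HeisRing.skewPart (conjLocal L (IsCMField.complexConj L) v) | Valued.v ((y : LocalRing L v) w) ≤ WithZero.exp (-2 : ℤ)} := isOpen_setOf_skew_valued_apply_le_exp_neg_two_of_ramified L v w hw he
  obtain ⟨hBpo, hBmo⟩ := isOpen_skewShell_isSquare_and_not_of_ramified L v w hw hϖ he
  have hAsm : MeasurableSet {x : LocalRing L v | Valued.v (x w) = WithZero.exp (-1 : ℤ)} := by
    rw [setOf_valued_apply_eq_exp_neg_one_eq_sdiff L v w]; exact hA1o.measurableSet.diff hA2o.measurableSet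
  have himg : ∀ (S : Set ↥(unipotentU (conjLocal L (IsCMField.complexConj L) v) (cmLocalForm L 3 v))) (A' : Set (LocalRing L v)) (B' : Set ↥(HeisRing.skewPart (conjLocal L (IsCMField.complexConj L) v))),
      (HeisRing.heisHomeomorph (conjLocal L (IsCMField.complexConj L) v) (conjLocal_conjLocal_cm L v) (continuous_conjLocal L (IsCMField.complexConj L) v)
        (cmLocalForm_eq_over L 3 v)) ⁻¹' S = A' ×ˢ B' → MeasurableSet A' → MeasurableSet B' → MeasurableSet S := by
    intro S A' B' hS hA' hB'
    rw [← (HeisRing.heisHomeomorph (conjLocal L (IsCMField.complexConj L) v) (conjLocal_conjLocal_cm L v) (continuous_conjLocal L (IsCMField.complexConj L) v)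
        (cmLocalForm_eq_over L 3 v)).image_preimage S, hS]
    exact (HeisRing.heisHomeomorph (conjLocal L (IsCMField.complexConj L) v) (conjLocal_conjLocal_cm L v) (continuous_conjLocal L (IsCMField.complexConj L) v)
        (cmLocalForm_eq_over L 3 v)).toMeasurableEquiv.measurableSet_image.2 (hA'.prod hB')
  obtain ⟨hpreP, hpreM⟩ := preimage_heisHomeomorph_levelTwoStratum_one_isSquare_of_ramified L v w hw hϖ h2w
  have hI2 : MeasurableSet {n : ↥(unipotentU (conjLocal L (IsCMField.complexConj L) v) (cmLocalForm L 3 v)) | (n : ↥(unitaryGroupOfForm (conjLocal L (IsCMField.complexConj L) v) (cmLocalForm L 3 v))) ∈ cmLocalIntegralLevel L 3 (Matrix.of fun i j : Fin 3 => if i.val + j.val + 1 = 3 then (1 : L) else 0) v ∧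
        (redMat (((n : ↥(unitaryGroupOfForm (conjLocal L (IsCMField.complexConj L) v) (cmLocalForm L 3 v))) : GL (Fin 3) (LocalRing L v)).val.map (Pi.evalRingHom (fun w' : PlacesOver L v => w'.1.adicCompletion L) w)) - 1).rank = 0 ∧
        (redMat (ϖ⁻¹ • ((((n : ↥(unitaryGroupOfForm (conjLocal L (IsCMField.complexConj L) v) (cmLocalForm L 3 v))) : GL (Fin 3) (LocalRing L v)).val.map (Pi.evalRingHom (fun w' : PlacesOver L v => w'.1.adicCompletion L) w)) - 1))).rank = 2} :=
    himg _ _ _ (preimage_heisHomeomorph_levelTwoStratum_two_of_valued_eq L v w hw hϖ h2w) hAsm hB1o.measurableSet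
  have hI1P : MeasurableSet {n : ↥(unipotentU (conjLocal L (IsCMField.complexConj L) v) (cmLocalForm L 3 v)) | (n : ↥(unitaryGroupOfForm (conjLocal L (IsCMField.complexConj L) v) (cmLocalForm L 3 v))) ∈ cmLocalIntegralLevel L 3 (Matrix.of fun i j : Fin 3 => if i.val + j.val + 1 = 3 then (1 : L) else 0) v ∧
        (redMat (((n : ↥(unitaryGroupOfForm (conjLocal L (IsCMField.complexConj L) v) (cmLocalForm L 3 v))) : GL (Fin 3) (LocalRing L v)).val.map (Pi.evalRingHom (fun w' : PlacesOver L v => w'.1.adicCompletion L) w)) - 1).rank = 0 ∧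
        (redMat (ϖ⁻¹ • ((((n : ↥(unitaryGroupOfForm (conjLocal L (IsCMField.complexConj L) v) (cmLocalForm L 3 v))) : GL (Fin 3) (LocalRing L v)).val.map (Pi.evalRingHom (fun w' : PlacesOver L v => w'.1.adicCompletion L) w)) - 1))).rank = 1 ∧ IsSquare (red (ϖ⁻¹ * (((n : ↥(unitaryGroupOfForm (conjLocal L (IsCMField.complexConj L) v) (cmLocalForm L 3 v))) : GL (Fin 3) (LocalRing L v)).val.map (Pi.evalRingHom (fun w' : PlacesOver L v => w'.1.adicCompletion L) w)) 0 2))} :=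
    himg _ _ _ hpreP hA2o.measurableSet hBpo.measurableSet
  have hI1M : MeasurableSet {n : ↥(unipotentU (conjLocal L (IsCMField.complexConj L) v) (cmLocalForm L 3 v)) | (n : ↥(unitaryGroupOfForm (conjLocal L (IsCMField.complexConj L) v) (cmLocalForm L 3 v))) ∈ cmLocalIntegralLevel L 3 (Matrix.of fun i j : Fin 3 => if i.val + j.val + 1 = 3 then (1 : L) else 0) v ∧
        (redMat (((n : ↥(unitaryGroupOfForm (conjLocal L (IsCMField.complexConj L) v) (cmLocalForm L 3 v))) : GL (Fin 3) (LocalRing L v)).val.map (Pi.evalRingHom (fun w' : PlacesOver L v => w'.1.adicCompletion L) w)) - 1).rank = 0 ∧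
        (redMat (ϖ⁻¹ • ((((n : ↥(unitaryGroupOfForm (conjLocal L (IsCMField.complexConj L) v) (cmLocalForm L 3 v))) : GL (Fin 3) (LocalRing L v)).val.map (Pi.evalRingHom (fun w' : PlacesOver L v => w'.1.adicCompletion L) w)) - 1))).rank = 1 ∧ ¬ IsSquare (red (ϖ⁻¹ * (((n : ↥(unitaryGroupOfForm (conjLocal L (IsCMField.complexConj L) v) (cmLocalForm L 3 v))) : GL (Fin 3) (LocalRing L v)).val.map (Pi.evalRingHom (fun w' : PlacesOver L v => w'.1.adicCompletion L) w)) 0 2))} :=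
    himg _ _ _ hpreM hA2o.measurableSet hBmo.measurableSet
  have hI0 : MeasurableSet {n : ↥(unipotentU (conjLocal L (IsCMField.complexConj L) v) (cmLocalForm L 3 v)) | (n : ↥(unitaryGroupOfForm (conjLocal L (IsCMField.complexConj L) v) (cmLocalForm L 3 v))) ∈ cmLocalIntegralLevel L 3 (Matrix.of fun i j : Fin 3 => if i.val + j.val + 1 = 3 then (1 : L) else 0) v ∧
        (redMat (((n : ↥(unitaryGroupOfForm (conjLocal L (IsCMField.complexConj L) v) (cmLocalForm L 3 v))) : GL (Fin 3) (LocalRing L v)).val.map (Pi.evalRingHom (fun w' : PlacesOver L v => w'.1.adicCompletion L) w)) - 1).rank = 0 ∧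
        (redMat (ϖ⁻¹ • ((((n : ↥(unitaryGroupOfForm (conjLocal L (IsCMField.complexConj L) v) (cmLocalForm L 3 v))) : GL (Fin 3) (LocalRing L v)).val.map (Pi.evalRingHom (fun w' : PlacesOver L v => w'.1.adicCompletion L) w)) - 1))).rank = 0} :=
    himg _ _ _ (preimage_heisHomeomorph_levelTwoStratum_zero_of_valued_eq L v w hw hϖ h2w) hA2o.measurableSet hB2o.measurableSet
  have hfin : μN {n : ↥(unipotentU (conjLocal L (IsCMField.complexConj L) v) (cmLocalForm L 3 v)) | (n : ↥(unitaryGroupOfForm (conjLocal L (IsCMField.complexConj L) v) (cmLocalForm L 3 v))) ∈ cmLocalIntegralLevel L 3 (Matrix.of fun i j : Fin 3 => if i.val + j.val + 1 = 3 then (1 : L) else 0) v} ≠ ∞ :=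
    (isCompact_setOf_mem_level L v w hw h2w).measure_lt_top.ne
  -- on `N ∩ K₃`: boundary rank `0` or `2`; over rank `0` the level-two rank is `0`, `1` or `2`
  have hcases : ∀ n : ↥(unipotentU (conjLocal L (IsCMField.complexConj L) v) (cmLocalForm L 3 v)), (n : ↥(unitaryGroupOfForm (conjLocal L (IsCMField.complexConj L) v) (cmLocalForm L 3 v))) ∈ cmLocalIntegralLevel L 3 (Matrix.of fun i j : Fin 3 => if i.val + j.val + 1 = 3 then (1 : L) else 0) v →
      ((redMat (((n : ↥(unitaryGroupOfForm (conjLocal L (IsCMField.complexConj L) v) (cmLocalForm L 3 v))) : GL (Fin 3) (LocalRing L v)).val.map (Pi.evalRingHom (fun w' : PlacesOver L v => w'.1.adicCompletion L) w)) - 1).rank = 0 ∧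
        ((redMat (ϖ⁻¹ • ((((n : ↥(unitaryGroupOfForm (conjLocal L (IsCMField.complexConj L) v) (cmLocalForm L 3 v))) : GL (Fin 3) (LocalRing L v)).val.map (Pi.evalRingHom (fun w' : PlacesOver L v => w'.1.adicCompletion L) w)) - 1))).rank = 0 ∨
          (redMat (ϖ⁻¹ • ((((n : ↥(unitaryGroupOfForm (conjLocal L (IsCMField.complexConj L) v) (cmLocalForm L 3 v))) : GL (Fin 3) (LocalRing L v)).val.map (Pi.evalRingHom (fun w' : PlacesOver L v => w'.1.adicCompletion L) w)) - 1))).rank = 1 ∨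
          (redMat (ϖ⁻¹ • ((((n : ↥(unitaryGroupOfForm (conjLocal L (IsCMField.complexConj L) v) (cmLocalForm L 3 v))) : GL (Fin 3) (LocalRing L v)).val.map (Pi.evalRingHom (fun w' : PlacesOver L v => w'.1.adicCompletion L) w)) - 1))).rank = 2)) ∨
      (redMat (((n : ↥(unitaryGroupOfForm (conjLocal L (IsCMField.complexConj L) v) (cmLocalForm L 3 v))) : GL (Fin 3) (LocalRing L v)).val.map (Pi.evalRingHom (fun w' : PlacesOver L v => w'.1.adicCompletion L) w)) - 1).rank = 2 := by
    intro n hn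
    have hn' := HeisRing.heisElt_heisX_heisY (conjLocal L (IsCMField.complexConj L) v) (conjLocal_conjLocal_cm L v) (cmLocalForm_eq_over L 3 v) n
    rw [← hn'] at hn ⊢
    obtain ⟨hx, hy⟩ := (heisElt_mem_cmLocalIntegralLevel_iff L v w hw h2w _ _).1 hn
    have hy' := valued_skew_apply_lt_one_of_ramified L v w hw he h2w _ hy
    rcases hx.lt_or_eq with hx' | hx'
    · refine Or.inl ⟨(rank_redMat_map_heisElt_sub_one_eq_zero_iff L v w hw h2w hx hy).2 ⟨hx', hy'⟩, ?_⟩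
      rcases valued_levelTwo_cases L v w hx' with hx2 | hx2
      · exact Or.inr (Or.inr (rank_redMat_smul_map_heisElt_sub_one_eq_two L v w hw hϖ hx2 _))
      · rcases valued_levelTwo_cases L v w hy' with hy2 | hy2
        · exact Or.inr (Or.inl (rank_redMat_smul_map_heisElt_sub_one_eq_one L v w hw hϖ h2w hx2 hy2))
        · exact Or.inl (rank_redMat_smul_map_heisElt_sub_one_eq_zero L v w hw hϖ h2w hx2 hy2)
    · exact Or.inr (rank_redMat_map_heisElt_sub_one_eq_two L v w hw hx' _)
  -- `F = v₅·1_{B₂} + v₃·1_{I₂} + v₂⁺·1_{I₁⁺} + v₂⁻·1_{I₁⁻} + v₁·1_{I₀}`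
  obtain ⟨S₅, hS₅⟩ : ∃ S : Set ↥(unipotentU (conjLocal L (IsCMField.complexConj L) v) (cmLocalForm L 3 v)), S = {n : ↥(unipotentU (conjLocal L (IsCMField.complexConj L) v) (cmLocalForm L 3 v)) | (n : ↥(unitaryGroupOfForm (conjLocal L (IsCMField.complexConj L) v) (cmLocalForm L 3 v))) ∈ cmLocalIntegralLevel L 3 (Matrix.of fun i j : Fin 3 => if i.val + j.val + 1 = 3 then (1 : L) else 0) v ∧
        (redMat (((n : ↥(unitaryGroupOfForm (conjLocal L (IsCMField.complexConj L) v) (cmLocalForm L 3 v))) : GL (Fin 3) (LocalRing L v)).val.map (Pi.evalRingHom (fun w' : PlacesOver L v => w'.1.adicCompletion L) w)) - 1).rank = 2} := ⟨_, rfl⟩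
  obtain ⟨S₃, hS₃⟩ : ∃ S : Set ↥(unipotentU (conjLocal L (IsCMField.complexConj L) v) (cmLocalForm L 3 v)), S = {n : ↥(unipotentU (conjLocal L (IsCMField.complexConj L) v) (cmLocalForm L 3 v)) | (n : ↥(unitaryGroupOfForm (conjLocal L (IsCMField.complexConj L) v) (cmLocalForm L 3 v))) ∈ cmLocalIntegralLevel L 3 (Matrix.of fun i j : Fin 3 => if i.val + j.val + 1 = 3 then (1 : L) else 0) v ∧
        (redMat (((n : ↥(unitaryGroupOfForm (conjLocal L (IsCMField.complexConj L) v) (cmLocalForm L 3 v))) : GL (Fin 3) (LocalRing L v)).val.map (Pi.evalRingHom (fun w' : PlacesOver L v => w'.1.adicCompletion L) w)) - 1).rank = 0 ∧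
        (redMat (ϖ⁻¹ • ((((n : ↥(unitaryGroupOfForm (conjLocal L (IsCMField.complexConj L) v) (cmLocalForm L 3 v))) : GL (Fin 3) (LocalRing L v)).val.map (Pi.evalRingHom (fun w' : PlacesOver L v => w'.1.adicCompletion L) w)) - 1))).rank = 2} := ⟨_, rfl⟩
  obtain ⟨Sp, hSp⟩ : ∃ S : Set ↥(unipotentU (conjLocal L (IsCMField.complexConj L) v) (cmLocalForm L 3 v)), S = {n : ↥(unipotentU (conjLocal L (IsCMField.complexConj L) v) (cmLocalForm L 3 v)) | (n : ↥(unitaryGroupOfForm (conjLocal L (IsCMField.complexConj L) v) (cmLocalForm L 3 v))) ∈ cmLocalIntegralLevel L 3 (Matrix.of fun i j : Fin 3 => if i.val + j.val + 1 = 3 then (1 : L) else 0) v ∧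
        (redMat (((n : ↥(unitaryGroupOfForm (conjLocal L (IsCMField.complexConj L) v) (cmLocalForm L 3 v))) : GL (Fin 3) (LocalRing L v)).val.map (Pi.evalRingHom (fun w' : PlacesOver L v => w'.1.adicCompletion L) w)) - 1).rank = 0 ∧
        (redMat (ϖ⁻¹ • ((((n : ↥(unitaryGroupOfForm (conjLocal L (IsCMField.complexConj L) v) (cmLocalForm L 3 v))) : GL (Fin 3) (LocalRing L v)).val.map (Pi.evalRingHom (fun w' : PlacesOver L v => w'.1.adicCompletion L) w)) - 1))).rank = 1 ∧ IsSquare (red (ϖ⁻¹ * (((n : ↥(unitaryGroupOfForm (conjLocal L (IsCMField.complexConj L) v) (cmLocalForm L 3 v))) : GL (Fin 3) (LocalRing L v)).val.map (Pi.evalRingHom (fun w' : PlacesOver L v => w'.1.adicCompletion L) w)) 0 2))} := ⟨_, rfl⟩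
  obtain ⟨Sm, hSm⟩ : ∃ S : Set ↥(unipotentU (conjLocal L (IsCMField.complexConj L) v) (cmLocalForm L 3 v)), S = {n : ↥(unipotentU (conjLocal L (IsCMField.complexConj L) v) (cmLocalForm L 3 v)) | (n : ↥(unitaryGroupOfForm (conjLocal L (IsCMField.complexConj L) v) (cmLocalForm L 3 v))) ∈ cmLocalIntegralLevel L 3 (Matrix.of fun i j : Fin 3 => if i.val + j.val + 1 = 3 then (1 : L) else 0) v ∧
        (redMat (((n : ↥(unitaryGroupOfForm (conjLocal L (IsCMField.complexConj L) v) (cmLocalForm L 3 v))) : GL (Fin 3) (LocalRing L v)).val.map (Pi.evalRingHom (fun w' : PlacesOver L v => w'.1.adicCompletion L) w)) - 1).rank = 0 ∧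
        (redMat (ϖ⁻¹ • ((((n : ↥(unitaryGroupOfForm (conjLocal L (IsCMField.complexConj L) v) (cmLocalForm L 3 v))) : GL (Fin 3) (LocalRing L v)).val.map (Pi.evalRingHom (fun w' : PlacesOver L v => w'.1.adicCompletion L) w)) - 1))).rank = 1 ∧ ¬ IsSquare (red (ϖ⁻¹ * (((n : ↥(unitaryGroupOfForm (conjLocal L (IsCMField.complexConj L) v) (cmLocalForm L 3 v))) : GL (Fin 3) (LocalRing L v)).val.map (Pi.evalRingHom (fun w' : PlacesOver L v => w'.1.adicCompletion L) w)) 0 2))} := ⟨_, rfl⟩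
  obtain ⟨S₁, hS₁⟩ : ∃ S : Set ↥(unipotentU (conjLocal L (IsCMField.complexConj L) v) (cmLocalForm L 3 v)), S = {n : ↥(unipotentU (conjLocal L (IsCMField.complexConj L) v) (cmLocalForm L 3 v)) | (n : ↥(unitaryGroupOfForm (conjLocal L (IsCMField.complexConj L) v) (cmLocalForm L 3 v))) ∈ cmLocalIntegralLevel L 3 (Matrix.of fun i j : Fin 3 => if i.val + j.val + 1 = 3 then (1 : L) else 0) v ∧
        (redMat (((n : ↥(unitaryGroupOfForm (conjLocal L (IsCMField.complexConj L) v) (cmLocalForm L 3 v))) : GL (Fin 3) (LocalRing L v)).val.map (Pi.evalRingHom (fun w' : PlacesOver L v => w'.1.adicCompletion L) w)) - 1).rank = 0 ∧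
        (redMat (ϖ⁻¹ • ((((n : ↥(unitaryGroupOfForm (conjLocal L (IsCMField.complexConj L) v) (cmLocalForm L 3 v))) : GL (Fin 3) (LocalRing L v)).val.map (Pi.evalRingHom (fun w' : PlacesOver L v => w'.1.adicCompletion L) w)) - 1))).rank = 0} := ⟨_, rfl⟩
  have hFsum : F = S₅.indicator (fun _ => v₅) + S₃.indicator (fun _ => v₃) + Sp.indicator (fun _ => v₂p) + Sm.indicator (fun _ => v₂m) + S₁.indicator (fun _ => v₁) := by
    funext n
    simp only [Pi.add_apply]
    by_cases hn : (n : ↥(unitaryGroupOfForm (conjLocal L (IsCMField.complexConj L) v) (cmLocalForm L 3 v))) ∈ cmLocalIntegralLevel L 3 (Matrix.of fun i j : Fin 3 => if i.val + j.val + 1 = 3 then (1 : L) else 0) v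
    · rcases hcases n hn with ⟨h, h' | h' | h'⟩ | h
      · have m5 : n ∉ S₅ := by rw [hS₅]; intro hm; rw [Set.mem_setOf_eq] at hm; exact absurd (h.symm.trans hm.2) (by decide)
        have m3 : n ∉ S₃ := by rw [hS₃]; intro hm; rw [Set.mem_setOf_eq] at hm; exact absurd (h'.symm.trans hm.2.2) (by decide)
        have mp : n ∉ Sp := by rw [hSp]; intro hm; rw [Set.mem_setOf_eq] at hm; exact absurd (h'.symm.trans hm.2.2.1) (by decide)
        have mm : n ∉ Sm := by rw [hSm]; intro hm; rw [Set.mem_setOf_eq] at hm; exact absurd (h'.symm.trans hm.2.2.1) (by decide)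
        have m1 : n ∈ S₁ := by rw [hS₁]; exact ⟨hn, h, h'⟩
        rw [hF₁ n hn h h', Set.indicator_of_notMem m5, Set.indicator_of_notMem m3, Set.indicator_of_notMem mp, Set.indicator_of_notMem mm, Set.indicator_of_mem m1]
        ring
      · have m5 : n ∉ S₅ := by rw [hS₅]; intro hm; rw [Set.mem_setOf_eq] at hm; exact absurd (h.symm.trans hm.2) (by decide)
        have m3 : n ∉ S₃ := by rw [hS₃]; intro hm; rw [Set.mem_setOf_eq] at hm; exact absurd (h'.symm.trans hm.2.2) (by decide)
        have m1 : n ∉ S₁ := by rw [hS₁]; intro hm; rw [Set.mem_setOf_eq] at hm; exact absurd (h'.symm.trans hm.2.2) (by decide)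
        by_cases hsq : IsSquare (red (ϖ⁻¹ * (((n : ↥(unitaryGroupOfForm (conjLocal L (IsCMField.complexConj L) v) (cmLocalForm L 3 v))) : GL (Fin 3) (LocalRing L v)).val.map (Pi.evalRingHom (fun w' : PlacesOver L v => w'.1.adicCompletion L) w)) 0 2))
        · have mp : n ∈ Sp := by rw [hSp]; exact ⟨hn, h, h', hsq⟩
          have mm : n ∉ Sm := by rw [hSm]; intro hm; rw [Set.mem_setOf_eq] at hm; exact hm.2.2.2 hsq
          rw [hF₂p n hn h h' hsq, Set.indicator_of_notMem m5, Set.indicator_of_notMem m3, Set.indicator_of_mem mp, Set.indicator_of_notMem mm, Set.indicator_of_notMem m1]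
          ring
        · have mp : n ∉ Sp := by rw [hSp]; intro hm; rw [Set.mem_setOf_eq] at hm; exact hsq hm.2.2.2
          have mm : n ∈ Sm := by rw [hSm]; exact ⟨hn, h, h', hsq⟩
          rw [hF₂m n hn h h' hsq, Set.indicator_of_notMem m5, Set.indicator_of_notMem m3, Set.indicator_of_notMem mp, Set.indicator_of_mem mm, Set.indicator_of_notMem m1]
          ring
      · have m5 : n ∉ S₅ := by rw [hS₅]; intro hm; rw [Set.mem_setOf_eq] at hm; exact absurd (h.symm.trans hm.2) (by decide)
        have m3 : n ∈ S₃ := by rw [hS₃]; exact ⟨hn, h, h'⟩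
        have mp : n ∉ Sp := by rw [hSp]; intro hm; rw [Set.mem_setOf_eq] at hm; exact absurd (h'.symm.trans hm.2.2.1) (by decide)
        have mm : n ∉ Sm := by rw [hSm]; intro hm; rw [Set.mem_setOf_eq] at hm; exact absurd (h'.symm.trans hm.2.2.1) (by decide)
        have m1 : n ∉ S₁ := by rw [hS₁]; intro hm; rw [Set.mem_setOf_eq] at hm; exact absurd (h'.symm.trans hm.2.2) (by decide)
        rw [hF₃ n hn h h', Set.indicator_of_notMem m5, Set.indicator_of_mem m3, Set.indicator_of_notMem mp, Set.indicator_of_notMem mm, Set.indicator_of_notMem m1]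
        ring
      · have m5 : n ∈ S₅ := by rw [hS₅]; exact ⟨hn, h⟩
        have m3 : n ∉ S₃ := by rw [hS₃]; intro hm; rw [Set.mem_setOf_eq] at hm; exact absurd (h.symm.trans hm.2.1) (by decide)
        have mp : n ∉ Sp := by rw [hSp]; intro hm; rw [Set.mem_setOf_eq] at hm; exact absurd (h.symm.trans hm.2.1) (by decide)
        have mm : n ∉ Sm := by rw [hSm]; intro hm; rw [Set.mem_setOf_eq] at hm; exact absurd (h.symm.trans hm.2.1) (by decide)
        have m1 : n ∉ S₁ := by rw [hS₁]; intro hm; rw [Set.mem_setOf_eq] at hm; exact absurd (h.symm.trans hm.2.1) (by decide)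
        rw [hF₅ n hn h, Set.indicator_of_mem m5, Set.indicator_of_notMem m3, Set.indicator_of_notMem mp, Set.indicator_of_notMem mm, Set.indicator_of_notMem m1]
        ring
    · have m5 : n ∉ S₅ := by rw [hS₅]; exact fun hm => hn hm.1
      have m3 : n ∉ S₃ := by rw [hS₃]; exact fun hm => hn hm.1
      have mp : n ∉ Sp := by rw [hSp]; exact fun hm => hn hm.1
      have mm : n ∉ Sm := by rw [hSm]; exact fun hm => hn hm.1
      have m1 : n ∉ S₁ := by rw [hS₁]; exact fun hm => hn hm.1
      rw [hF₀ n hn, Set.indicator_of_notMem m5, Set.indicator_of_notMem m3, Set.indicator_of_notMem mp, Set.indicator_of_notMem mm, Set.indicator_of_notMem m1]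
      ring
  have hS5m : MeasurableSet S₅ := by rw [hS₅]; exact hS2
  have hS3m : MeasurableSet S₃ := by rw [hS₃]; exact hI2
  have hSpm : MeasurableSet Sp := by rw [hSp]; exact hI1P
  have hSmm : MeasurableSet Sm := by rw [hSm]; exact hI1M
  have hS1m : MeasurableSet S₁ := by rw [hS₁]; exact hI0
  have hfS : ∀ S : Set ↥(unipotentU (conjLocal L (IsCMField.complexConj L) v) (cmLocalForm L 3 v)), S ⊆ {n : ↥(unipotentU (conjLocal L (IsCMField.complexConj L) v) (cmLocalForm L 3 v)) | (n : ↥(unitaryGroupOfForm (conjLocal L (IsCMField.complexConj L) v) (cmLocalForm L 3 v))) ∈ cmLocalIntegralLevel L 3 (Matrix.of fun i j : Fin 3 => if i.val + j.val + 1 = 3 then (1 : L) else 0) v} → μN S ≠ ∞ :=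
    fun S hS => ne_top_of_le_ne_top hfin (measure_mono hS)
  have hf5 : μN S₅ ≠ ∞ := hfS S₅ (by rw [hS₅]; exact fun n hn => hn.1)
  have hf3 : μN S₃ ≠ ∞ := hfS S₃ (by rw [hS₃]; exact fun n hn => hn.1)
  have hfp : μN Sp ≠ ∞ := hfS Sp (by rw [hSp]; exact fun n hn => hn.1)
  have hfm : μN Sm ≠ ∞ := hfS Sm (by rw [hSm]; exact fun n hn => hn.1)
  have hf1 : μN S₁ ≠ ∞ := hfS S₁ (by rw [hS₁]; exact fun n hn => hn.1)
  have hI : ∀ (S : Set ↥(unipotentU (conjLocal L (IsCMField.complexConj L) v) (cmLocalForm L 3 v))) (c : ℂ), MeasurableSet S → μN S ≠ ∞ → Integrable (S.indicator (fun _ => c)) μN :=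
    fun S c hS hSf => (integrable_indicator_iff hS).2 (integrableOn_const hSf)
  have e5 : μN.real S₅ = (Ideal.absNorm v.asIdeal : ℝ)⁻¹ * ((Ideal.absNorm v.asIdeal : ℝ) - 1) * μN.real {n : ↥(unipotentU (conjLocal L (IsCMField.complexConj L) v) (cmLocalForm L 3 v)) | (n : ↥(unitaryGroupOfForm (conjLocal L (IsCMField.complexConj L) v) (cmLocalForm L 3 v))) ∈ cmLocalIntegralLevel L 3 (Matrix.of fun i j : Fin 3 => if i.val + j.val + 1 = 3 then (1 : L) else 0) v} := by
    rw [hS₅]; exact measureReal_rankStratum_two_of_ramified L v w hw μN he h2w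
  have e3 : μN.real S₃ = (Ideal.absNorm v.asIdeal : ℝ)⁻¹ * (1 - (Ideal.absNorm v.asIdeal : ℝ)⁻¹) * μN.real {n : ↥(unipotentU (conjLocal L (IsCMField.complexConj L) v) (cmLocalForm L 3 v)) | (n : ↥(unitaryGroupOfForm (conjLocal L (IsCMField.complexConj L) v) (cmLocalForm L 3 v))) ∈ cmLocalIntegralLevel L 3 (Matrix.of fun i j : Fin 3 => if i.val + j.val + 1 = 3 then (1 : L) else 0) v} := by
    rw [hS₃]; exact measureReal_levelTwoStratum_two_of_ramified L v w hw μN hϖ he h2w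
  obtain ⟨eP, eM⟩ := measureReal_levelTwoStratum_one_isSquare_of_ramified L v w hw μN hϖ he h2w
  have ep : μN.real Sp = 2⁻¹ * (((Ideal.absNorm v.asIdeal : ℝ) ^ 2)⁻¹ * (1 - (Ideal.absNorm v.asIdeal : ℝ)⁻¹)) * μN.real {n : ↥(unipotentU (conjLocal L (IsCMField.complexConj L) v) (cmLocalForm L 3 v)) | (n : ↥(unitaryGroupOfForm (conjLocal L (IsCMField.complexConj L) v) (cmLocalForm L 3 v))) ∈ cmLocalIntegralLevel L 3 (Matrix.of fun i j : Fin 3 => if i.val + j.val + 1 = 3 then (1 : L) else 0) v} := by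
    rw [hSp]; exact eP
  have em : μN.real Sm = 2⁻¹ * (((Ideal.absNorm v.asIdeal : ℝ) ^ 2)⁻¹ * (1 - (Ideal.absNorm v.asIdeal : ℝ)⁻¹)) * μN.real {n : ↥(unipotentU (conjLocal L (IsCMField.complexConj L) v) (cmLocalForm L 3 v)) | (n : ↥(unitaryGroupOfForm (conjLocal L (IsCMField.complexConj L) v) (cmLocalForm L 3 v))) ∈ cmLocalIntegralLevel L 3 (Matrix.of fun i j : Fin 3 => if i.val + j.val + 1 = 3 then (1 : L) else 0) v} := by
    rw [hSm]; exact eM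
  have e1 : μN.real S₁ = ((Ideal.absNorm v.asIdeal : ℝ) ^ 3)⁻¹ * μN.real {n : ↥(unipotentU (conjLocal L (IsCMField.complexConj L) v) (cmLocalForm L 3 v)) | (n : ↥(unitaryGroupOfForm (conjLocal L (IsCMField.complexConj L) v) (cmLocalForm L 3 v))) ∈ cmLocalIntegralLevel L 3 (Matrix.of fun i j : Fin 3 => if i.val + j.val + 1 = 3 then (1 : L) else 0) v} := by
    rw [hS₁]; exact measureReal_levelTwoStratum_zero_of_ramified L v w hw μN hϖ he h2w
  rw [hFsum, integral_add' ((((hI S₅ v₅ hS5m hf5).add (hI S₃ v₃ hS3m hf3)).add (hI Sp v₂p hSpm hfp)).add (hI Sm v₂m hSmm hfm)) (hI S₁ v₁ hS1m hf1),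
    integral_add' (((hI S₅ v₅ hS5m hf5).add (hI S₃ v₃ hS3m hf3)).add (hI Sp v₂p hSpm hfp)) (hI Sm v₂m hSmm hfm),
    integral_add' ((hI S₅ v₅ hS5m hf5).add (hI S₃ v₃ hS3m hf3)) (hI Sp v₂p hSpm hfp), integral_add' (hI S₅ v₅ hS5m hf5) (hI S₃ v₃ hS3m hf3),
    integral_indicator_const _ hS5m, integral_indicator_const _ hS3m, integral_indicator_const _ hSpm, integral_indicator_const _ hSmm,
    integral_indicator_const _ hS1m, Complex.real_smul, Complex.real_smul, Complex.real_smul, Complex.real_smul, Complex.real_smul, e5, e3, ep, em, e1]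
  push_cast
  field_simp
  ring

end Literature.NumberTheory.Automorphic.UnitaryGroup

end
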